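import Summits.BirchSwinnertonDyer.BirchSwinnertonDyer.Theorems.KolyvaginRoadThreeSchneiderTamAtThreeHeightLogNumeratorDeep
import Summits.BirchSwinnertonDyer.BirchSwinnertonDyer.Theorems.KolyvaginRoadThreeSchneiderTamAtThreeHeightLogNumeratorDeepRefinedSeries
import Summits.BirchSwinnertonDyer.BirchSwinnertonDyer.Theorems.ClassRecordThreeRegCertKernelO3Sigma
import HarnessLib

/-!
# Crux `SchneiderTamAtThree` (item 19154) — THE HEIGHT IS THE LOGARITHM OF THE NUMERATOR, DEEP POINTS,
# part 6: the deep-point law TO ORDER `q` (explicit `q`-linear term `−60(c₆/c₄)·q·x⁻¹`)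

HONEST FRAMING (cell `bsd-stepL`, seat `bsd-stepL-tam3-p2` g2, WIDTH-LEVER second lane «closed-form Schneider
local factor at 3 … finite case table proved once»; `--supports stmt-BirchSwinnertonDyer-19154 --as helper`):
THEOREMS ONLY, unconditional, route-independent (no Theses import); 0 definitions, 0 named facts, 0 sorry;
nothing here proves the crux `SchneiderTamAtThree`, Schneider's conjecture or BSD.

* `norm_heightFourOneCoord_sub_padicLog_num_sub_sub_le_deep` — for `W/ℚ` globally minimal, multiplicative at
  `3`, `‖q‖₃ < 1`, a rational point of level `k ≥ 2`: **`‖ĥ₃(P) − log₃ num x − ((b₂b₄ − 18b₆)/c₄)·den x/num x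
  − 60(c₆/c₄)·q·den x/num x‖₃ ≤ ‖x‖₃⁻¹·max(‖x‖₃⁻¹, ‖q‖₃²)`** — the law to ORDER `q` (part 3b had `O(q)`);
  its corollaries (part 6b) are the precisions `2k + min(2k, ν+1)` and, for the Tate parameter, `2k + min(2k, 2ν)`. The two `O(q)`-terms — `−2qC₀x⁻¹`
  from `Π = 1 − 4q(ch L − 1) + O(q²(ch L − 1))` (lane A's `KernelCert.norm_tprod_tateSigmaSq_factor_sub_linear_le`)
  and `+62qC₀x⁻¹` from `C⁻² = C₀(1 + 744q) + O(3⁻¹q²)` (part 5), `C₀ = −c₆/c₄` — add up to `60C₀q·x⁻¹`, `3 ∣ 60`.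
* `deep_refined_logPr`, `norm_formalLog_sq_sub_inv_le` — the abstract bookkeeping of the `q`-terms.
References: [SteinWuthrich2013] §4.2; [SilvermanATAEC1994] V.3; [Iwasawa1972PadicL] §4.4; lane A `…KernelO3Sigma`.
-/

noncomputable section
open scoped Classical Nat
open Filter Topology IsUltrametricDist PowerSeries
open WeierstrassCurve Literature.NumberTheory.EllipticCurves
open Literature.NumberTheory.EllipticCurves.SteinWuthrich2013
open Literature.NumberTheory.EllipticCurves.TateCurve
open Literature.NumberTheory.EllipticCurves.Rank1Residual
open Summit.BirchSwinnertonDyer.Uniform.UI.O2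

namespace Summit.BirchSwinnertonDyer.Rank1Residual.X11b.RegMult.HeightLogNumerator

/-! ### §13 The `q`-terms -/

section QTerms
/-- `‖ℓ² − X⁻¹‖ ≤ 3‖z‖⁴` from the fourth-order relation (`ℓ² − X⁻¹ = X⁻¹·(Xℓ² − 1)`,
`‖Xℓ² − 1‖ ≤ 3‖z‖²`). [folklore] -/
theorem norm_formalLog_sq_sub_inv_le {X ℓ b₂ b₄ : ℚ_[3]} {r : ℝ} (hX0 : X ≠ 0) (hXi2 : ‖X⁻¹‖ = r ^ 2)
    (hℓn : ‖ℓ‖ = r) (hr : 0 < r) (hr9 : r ≤ 1 / 9) (hb2n : ‖b₂‖ ≤ 1) (hb4n : ‖b₄‖ ≤ 1)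
    (hXℓ : ‖X * ℓ ^ 2 - 1 + b₂ / 12 * ℓ ^ 2 - (b₂ ^ 2 - 24 * b₄) / 240 * ℓ ^ 4‖ ≤ r ^ 4) :
    ‖ℓ ^ 2 - X⁻¹‖ ≤ 3 * r ^ 4 := by
  obtain ⟨hz1, h3z, h9z, h27z2, h3z2, hz2le, -, -, -, -, -, -, -, -⟩ := deep_numerics r hr hr9
  obtain ⟨h2n, h4n, h3n, h3i, h9i, h12i, -, -, -, -⟩ := padic_three_constants
  have hb12 : ‖b₂ / 12‖ ≤ 3 := by
    rw [div_eq_mul_inv, norm_mul, h12i]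
    calc ‖b₂‖ * 3 ≤ 1 * 3 := by gcongr
      _ = 3 := one_mul _
  have hc4n : ‖b₂ ^ 2 - 24 * b₄‖ ≤ 1 := by
    refine (norm_sub_le_max₃ _ _).trans (max_le ?_ ?_)
    · rw [norm_pow]; exact pow_le_one₀ (norm_nonneg _) hb2n
    · rw [norm_mul]
      have h24 : ‖(24 : ℚ_[3])‖ ≤ 1 := by
        have h : ((24 : ℤ) : ℚ_[3]) = 24 := by norm_cast
        rw [← h]; exact Padic.norm_int_le_one 24
      calc ‖(24 : ℚ_[3])‖ * ‖b₄‖ ≤ 1 * 1 := by gcongr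
        _ = 1 := one_mul _
  have h240i : ‖(240 : ℚ_[3])⁻¹‖ = 3 := by
    have h80 : ‖(80 : ℚ_[3])‖ = 1 := by
      simpa using Padic.norm_natCast_eq_one_iff.mpr (show Nat.Coprime 3 80 by decide)
    rw [show (240 : ℚ_[3]) = 80 * 3 by norm_num, mul_inv, norm_mul, h3i, norm_inv, h80]; norm_num
  have hu : ‖X * ℓ ^ 2 - 1‖ ≤ 3 * r ^ 2 := by
    have e : X * ℓ ^ 2 - 1 = (X * ℓ ^ 2 - 1 + b₂ / 12 * ℓ ^ 2 - (b₂ ^ 2 - 24 * b₄) / 240 * ℓ ^ 4) -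
        b₂ / 12 * ℓ ^ 2 + (b₂ ^ 2 - 24 * b₄) / 240 * ℓ ^ 4 := by ring
    rw [e]
    refine (norm_add_le_max _ _).trans (max_le ((norm_sub_le_max₃ _ _).trans (max_le (hXℓ.trans ?_) ?_)) ?_)
    · calc r ^ 4 = r ^ 2 * r ^ 2 := by ring
        _ ≤ 1 * r ^ 2 := by gcongr; exact pow_le_one₀ hr.le hz1
        _ ≤ 3 * r ^ 2 := by linarith [pow_nonneg hr.le 2]
    · rw [norm_mul, norm_pow, hℓn]
      exact mul_le_mul_of_nonneg_right hb12 (by positivity)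
    · rw [norm_mul, norm_pow, hℓn, div_eq_mul_inv, norm_mul, h240i]
      calc ‖b₂ ^ 2 - 24 * b₄‖ * 3 * r ^ 4 ≤ 1 * 3 * r ^ 4 := by gcongr
        _ = 3 * (r ^ 2 * r ^ 2) := by ring
        _ ≤ 3 * (r ^ 2 * 1) := by gcongr; exact pow_le_one₀ hr.le hz1
        _ = 3 * r ^ 2 := by ring
  have e : ℓ ^ 2 - X⁻¹ = X⁻¹ * (X * ℓ ^ 2 - 1) := by
    rw [mul_sub, mul_one, ← mul_assoc, inv_mul_cancel₀ hX0, one_mul]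
  rw [e, norm_mul, hXi2]
  calc r ^ 2 * ‖X * ℓ ^ 2 - 1‖ ≤ r ^ 2 * (3 * r ^ 2) := by gcongr
    _ = 3 * r ^ 4 := by ring

/-- **The logarithm of the sigma product to order `q`: `‖log₃ Π + 2q·C₀·X⁻¹‖ ≤ 3⁻¹‖q‖‖z‖²`.** Abstract
bookkeeping: `log Π + 2qC₀X⁻¹ = [log Π − (Π−1)] + [Π − (1 − 4q(c−1))] − 2q[2(c−1) − L] − 2qC[ℓ² − X⁻¹]
− 2q(C − C₀)X⁻¹` (`L = Cℓ²`), and each bracket is small: `(‖q‖r²)²`, `‖q‖²r²` (lane A's product lemma),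
`3‖q‖r⁴`, `3‖q‖r⁴`, `3⁻¹‖q‖²r²`, all `≤ 3⁻¹‖q‖r²` for `‖q‖ ≤ 3⁻¹`, `r ≤ 3⁻²`. [folklore] -/
theorem deep_refined_logPr {q c L ℓ X C2 C0 P : ℚ_[3]} {r : ℝ} (hq3 : ‖q‖ ≤ 3⁻¹) (hr : 0 < r)
    (hr9 : r ≤ 1 / 9) (hLn : ‖L‖ = r ^ 2) (hL : L = ℓ ^ 2 / C2) (hCi : ‖C2⁻¹‖ = 1)
    (hCC0 : ‖C2⁻¹ - C0‖ ≤ 3⁻¹ * ‖q‖) (hXi2 : ‖X⁻¹‖ = r ^ 2) (hℓX : ‖ℓ ^ 2 - X⁻¹‖ ≤ 3 * r ^ 4)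
    (hPrlin : ‖P - (1 - 4 * q * (c - 1))‖ ≤ ‖q‖ ^ 2 * r ^ 2)
    (hlogPr : ‖padicLog 3 P - (P - 1)‖ ≤ (‖q‖ * r ^ 2) ^ 2) (hcL : ‖2 * (c - 1) - L‖ ≤ 3 * ‖L‖ ^ 2) :
    ‖padicLog 3 P + 2 * q * C0 * X⁻¹‖ ≤ r ^ 2 * max (r ^ 2) (‖q‖ ^ 2) := by
  obtain ⟨hz1, h3z, h9z, h27z2, h3z2, hz2le, -, -, -, -, -, -, -, -⟩ := deep_numerics r hr hr9
  have h2n : ‖(2 : ℚ_[3])‖ = 1 := by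
    simpa using Padic.norm_natCast_eq_one_iff.mpr (show Nat.Coprime 3 2 by decide)
  have hC20 : C2 ≠ 0 := by
    intro h; rw [h, inv_zero, norm_zero] at hCi; exact zero_ne_one hCi
  have hq0 : 0 ≤ ‖q‖ := norm_nonneg _
  have hq1 : ‖q‖ ≤ 1 := hq3.trans (by norm_num)
  have e : padicLog 3 P + 2 * q * C0 * X⁻¹ =
      (padicLog 3 P - (P - 1)) + (P - (1 - 4 * q * (c - 1))) - 2 * q * (2 * (c - 1) - L) -
        2 * q * C2⁻¹ * (ℓ ^ 2 - X⁻¹) - 2 * q * (C2⁻¹ - C0) * X⁻¹ := by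
    rw [hL]; field_simp; ring
  rw [e]
  have hB1 : r ^ 4 ≤ r ^ 2 * max (r ^ 2) (‖q‖ ^ 2) := by
    rw [show r ^ 4 = r ^ 2 * r ^ 2 by ring]; gcongr; exact le_max_left _ _
  have hB2 : ‖q‖ ^ 2 * r ^ 2 ≤ r ^ 2 * max (r ^ 2) (‖q‖ ^ 2) := by
    rw [mul_comm]; gcongr; exact le_max_right _ _
  have h3qr : 3 * ‖q‖ * r ^ 4 ≤ r ^ 4 := by
    calc 3 * ‖q‖ * r ^ 4 ≤ 3 * 3⁻¹ * r ^ 4 := by gcongr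
      _ = r ^ 4 := by ring
  refine (norm_sub_le_max₃ _ _).trans (max_le ((norm_sub_le_max₃ _ _).trans (max_le
    ((norm_sub_le_max₃ _ _).trans (max_le ((norm_add_le_max _ _).trans (max_le (hlogPr.trans ?_)
    (hPrlin.trans hB2))) ?_)) ?_)) ?_)
  · refine le_trans ?_ hB2
    calc (‖q‖ * r ^ 2) ^ 2 = ‖q‖ ^ 2 * r ^ 2 * r ^ 2 := by ring
      _ ≤ ‖q‖ ^ 2 * r ^ 2 * 1 := by gcongr; exact pow_le_one₀ hr.le hz1
      _ = ‖q‖ ^ 2 * r ^ 2 := mul_one _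
  · rw [norm_mul, norm_mul, h2n, one_mul]
    refine le_trans ?_ (h3qr.trans hB1)
    calc ‖q‖ * ‖2 * (c - 1) - L‖ ≤ ‖q‖ * (3 * ‖L‖ ^ 2) := by gcongr
      _ = 3 * ‖q‖ * r ^ 4 := by rw [hLn]; ring
  · rw [norm_mul, norm_mul, norm_mul, h2n, one_mul, hCi, mul_one]
    refine le_trans ?_ (h3qr.trans hB1)
    calc ‖q‖ * ‖ℓ ^ 2 - X⁻¹‖ ≤ ‖q‖ * (3 * r ^ 4) := by gcongr
      _ = 3 * ‖q‖ * r ^ 4 := by ring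
  · rw [norm_mul, norm_mul, norm_mul, h2n, one_mul, hXi2]
    refine le_trans ?_ hB2
    calc ‖q‖ * ‖C2⁻¹ - C0‖ * r ^ 2 ≤ ‖q‖ * (3⁻¹ * ‖q‖) * r ^ 2 := by gcongr
      _ = 3⁻¹ * (‖q‖ ^ 2 * r ^ 2) := by ring
      _ ≤ 1 * (‖q‖ ^ 2 * r ^ 2) := by gcongr; norm_num
      _ = ‖q‖ ^ 2 * r ^ 2 := one_mul _

end QTerms

/-! ### §14 The refined deep-point law -/

section Deep

variable {W : WeierstrassCurve ℚ}

/-- **THE DEEP-POINT LAW TO ORDER `q`.** For `W/ℚ` globally minimal with multiplicative reduction at `3`,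
any `q ∈ ℚ₃` with `‖q‖₃ < 1` and any rational affine point `P = (x, y)` of level `≥ 2` (`‖z(P)‖₃ ≤ 3⁻²`):
`‖ĥ₃(P) − log₃(num x) − κ₀'·D/a − 60(c₆/c₄)·q·D/a‖₃ ≤ ‖x‖₃⁻¹·max(‖x‖₃⁻¹, ‖q‖₃²)` (`a = num x`, `D = den x`,
`κ₀' = (b₂b₄ − 18b₆)/c₄`). Same skeleton as part 3b; the two `q`-linear terms (`Π` to order `q`, lane A;
the scale to order `q`, part 5) are made explicit and add up to `−60(c₆/c₄)q·x⁻¹`. Corollaries (next file):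
dropping the `q`-term (norm `3⁻¹‖q‖‖x‖⁻¹`) gives precision `2k + min(2k, ν+1)`; for THE Tate parameter
(`q ≡ 1/j = Δ/c₄³ mod q²`) the rational closed form `log₃ a + [κ₀' + 60c₆Δ/c₄⁴]·D/a` to precision
`2k + min(2k, 2ν)` — both observed on all 690 rows of lane A's table (kit j285773 and seat numerics).
[cite: SteinWuthrich2013, §4.1 eq. (4.1), §4.2] [cite: SilvermanATAEC1994, Thm. V.3.1 (b)] [cite: Iwasawa1972PadicL, §4.4] -/
theorem norm_heightFourOneCoord_sub_padicLog_num_sub_sub_le_deep [W.IsElliptic] [W.IsGloballyMinimal]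
    (hW : Mult W 3) {q : ℚ_[3]} (hq : ‖q‖ < 1) {x y : ℚ} (hxy : W.toAffine.Nonsingular x y)
    (hx : 1 < ‖(x : ℚ_[3])‖) (hz9 : ‖-(x : ℚ_[3]) / y‖ ≤ 1 / 9) :
    ‖heightFourOneCoord W 3 q x y - padicLog 3 ((x.num : ℚ) : ℚ_[3]) -
        ((W.baseChange ℚ_[3]).b₂ * (W.baseChange ℚ_[3]).b₄ - 18 * (W.baseChange ℚ_[3]).b₆) /
          (W.baseChange ℚ_[3]).c₄ * (((x.den : ℚ) : ℚ_[3]) / ((x.num : ℚ) : ℚ_[3])) -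
        60 * ((W.baseChange ℚ_[3]).c₆ / (W.baseChange ℚ_[3]).c₄) * q *
          (((x.den : ℚ) : ℚ_[3]) / ((x.num : ℚ) : ℚ_[3]))‖
      ≤ ‖(x : ℚ_[3])‖⁻¹ * max ‖(x : ℚ_[3])‖⁻¹ (‖q‖ ^ 2) := by
  -- the objects
  set X : ℚ_[3] := (x : ℚ_[3]) with hXdef
  set Y : ℚ_[3] := (y : ℚ_[3]) with hYdef
  set V : WeierstrassCurve ℚ_[3] := W.baseChange ℚ_[3] with hVdef
  set z : ℚ_[3] := -X / Y with hzdef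
  set ℓ : ℚ_[3] := V.padicFormalLog z with hℓdef
  set C2 : ℚ_[3] := uniformisationScaleSq W 3 q with hC2def
  set L : ℚ_[3] := logUnitParamSq W 3 q x y with hLdef
  set c : ℚ_[3] := coshOfSq L with hcdef
  set Pr : ℚ_[3] := ∏' n : ℕ, (1 - 2 * q ^ (n + 1) * c + q ^ (2 * (n + 1))) ^ 2 /
    (1 - q ^ (n + 1)) ^ 4 with hPrdef
  set κ' : ℚ_[3] := (V.b₂ * V.b₄ - 18 * V.b₆) / V.c₄ with hκ'def
  have hSig : tateSigmaValueSq W 3 q x y = C2 * (2 * (c - 1) * Pr) := rfl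
  have hL : L = ℓ ^ 2 / C2 := rfl
  -- basic norms
  obtain ⟨hz, hz2⟩ := norm_neg_div_of_one_lt_norm (p := 3) hxy hx
  have hX0 : 0 < ‖X‖ := one_pos.trans hx
  have hX0' : X ≠ 0 := norm_pos_iff.mp hX0
  have hXinv : ‖X‖⁻¹ = ‖z‖ ^ 2 := hz2.symm
  have hzz : 0 < ‖z‖ := by
    have h : 0 < ‖z‖ ^ 2 := by rw [hz2]; exact inv_pos.mpr hX0
    rcases (norm_nonneg z).eq_or_lt with h0 | h0
    · rw [← h0] at h; norm_num at h
    · exact h0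
  have hz0 : z ≠ 0 := norm_pos_iff.mp hzz
  obtain ⟨hz1, h3z, h9z, h27z2, h3z2, hz2le, -, hr6, -, -, -, h3r5, hr6', -⟩ := deep_numerics ‖z‖ hzz hz9
  obtain ⟨h2n, h4n, h3n, h3i, h9i, h12i, -, -, -, -⟩ := padic_three_constants
  have h81 : 81 * ‖z‖ ^ 2 ≤ 1 := by
    calc 81 * ‖z‖ ^ 2 = (9 * ‖z‖) * (9 * ‖z‖) := by ring
      _ ≤ 1 * 1 := mul_le_mul h9z h9z (by positivity) zero_le_one
      _ = 1 := one_mul _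
  have hC : ‖C2‖ = 1 := norm_uniformisationScaleSq_eq_one hW hq
  have hC0 : C2 ≠ 0 := norm_pos_iff.mp (by rw [hC]; exact one_pos)
  have hCi : ‖C2⁻¹‖ = 1 := by rw [norm_inv, hC, inv_one]
  have heq : V.toAffine.Equation X Y := (nonsingular_ratCast (p := 3) hxy).left
  obtain ⟨hsq, hxyn⟩ := V.norm_sq_eq_norm_cube heq hx
  have hY0 : Y ≠ 0 := norm_pos_iff.mp (hX0.trans hxyn)
  have hd0 : ((x.den : ℚ) : ℚ_[3]) ≠ 0 := by exact_mod_cast x.den_nz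
  have hS0 := tateSigmaValueSq_ne_zero (p := 3) (by norm_num) hW hq hxy hx
  have hnum : ((x.num : ℚ) : ℚ_[3]) = X * ((x.den : ℚ) : ℚ_[3]) := by
    rw [hXdef, ← Rat.cast_mul, Rat.mul_den_eq_num]
  -- the scale facts (part 1 §3, deep part 1 §4)
  obtain ⟨hb2n, hb4n, -⟩ : ‖V.b₂‖ ≤ 1 ∧ ‖V.b₄‖ ≤ 1 ∧ ‖V.b₆‖ ≤ 1 := by
    have h := V.eq_map_integralModel
    refine ⟨?_, ?_, ?_⟩
    · have e := congrArg WeierstrassCurve.b₂ h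
      rw [map_b₂] at e; rw [← e]; exact PadicInt.norm_le_one _
    · have e := congrArg WeierstrassCurve.b₄ h
      rw [map_b₄] at e; rw [← e]; exact PadicInt.norm_le_one _
    · have e := congrArg WeierstrassCurve.b₆ h
      rw [map_b₆] at e; rw [← e]; exact PadicInt.norm_le_one _
  have hCb : ‖C2⁻¹ - V.b₂‖ ≤ 1 / 3 := norm_inv_scaleSq_sub_b₂_le hW hq
  have hκq : ‖(C2⁻¹ - V.b₂) / 12 + κ' + 62 * (V.c₆ / V.c₄) * q‖ ≤ ‖q‖ ^ 2 :=
    norm_kappa_add_sub_linear_le hW hq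
  have hCC0 : ‖C2⁻¹ - -(V.c₆ / V.c₄)‖ ≤ 3⁻¹ * ‖q‖ := by
    rw [sub_neg_eq_add]; exact norm_inv_scaleSq_add_c₆_div_c₄_le hW hq
  have hq3 : ‖q‖ ≤ 3⁻¹ := by
    have h := norm_le_inv_of_norm_lt_one hq
    exact h.trans (by norm_num)
  have hc4def : V.c₄ = V.b₂ ^ 2 - 24 * V.b₄ := rfl
  -- the three logarithms
  have hlog1 : ‖padicLog 3 (X * ℓ ^ 2) - (-(V.b₂ / 12) * ℓ ^ 2 + (V.c₄ / 240 - V.b₂ ^ 2 / 288) * ℓ ^ 4)‖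
      ≤ ‖z‖ ^ 4 := by
    have h := norm_padicLog_x_mul_formalLog_sq_sub_le V heq hx hz9
    rw [hXinv] at h
    exact h.trans_eq (by ring)
  have hXℓ : ‖X * ℓ ^ 2 - 1 + V.b₂ / 12 * ℓ ^ 2 - V.c₄ / 240 * ℓ ^ 4‖ ≤ ‖z‖ ^ 4 := by
    have h := norm_x_mul_formalLog_sq_sub_le V heq hx hz9
    rw [hXinv] at h
    exact h.trans_eq (by ring)
  have hℓτ := norm_padicFormalLog_sub_cubic_le_pow_four V (hz9.trans (by norm_num))
  have hℓn : ‖ℓ‖ = ‖z‖ := by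
    obtain ⟨ha1, ha2, -, -, -⟩ := V.norm_coeffs_le_one
    have hw : ‖ℓ - z‖ ≤ ‖z‖ ^ 2 := by
      have e : ℓ - z = (ℓ - (z + (2 : ℚ_[3])⁻¹ * V.a₁ * z ^ 2 + (3 : ℚ_[3])⁻¹ * (V.a₁ ^ 2 + V.a₂) * z ^ 3)) +
          ((2 : ℚ_[3])⁻¹ * V.a₁ * z ^ 2 + (3 : ℚ_[3])⁻¹ * (V.a₁ ^ 2 + V.a₂) * z ^ 3) := by ring
      rw [e]
      refine (norm_add_le_max _ _).trans (max_le (hℓτ.trans ?_) ((norm_add_le_max _ _).trans (max_le ?_ ?_)))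
      · calc ‖z‖ ^ 4 = ‖z‖ ^ 2 * ‖z‖ ^ 2 := by ring
          _ ≤ ‖z‖ ^ 2 * 1 := by gcongr; exact pow_le_one₀ (norm_nonneg _) hz1
          _ = ‖z‖ ^ 2 := mul_one _
      · rw [norm_mul, norm_mul, norm_inv, h2n, inv_one, one_mul, norm_pow]
        calc ‖V.a₁‖ * ‖z‖ ^ 2 ≤ 1 * ‖z‖ ^ 2 := by gcongr
          _ = ‖z‖ ^ 2 := one_mul _
      · rw [norm_mul, norm_mul, h3i, norm_pow]
        have ha12 : ‖V.a₁ ^ 2 + V.a₂‖ ≤ 1 := (norm_add_le_max _ _).trans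
          (max_le (by rw [norm_pow]; exact pow_le_one₀ (norm_nonneg _) ha1) ha2)
        calc 3 * ‖V.a₁ ^ 2 + V.a₂‖ * ‖z‖ ^ 3 ≤ 3 * 1 * ‖z‖ ^ 3 := by gcongr
          _ = (3 * ‖z‖) * ‖z‖ ^ 2 := by ring
          _ ≤ 1 * ‖z‖ ^ 2 := by gcongr
          _ = ‖z‖ ^ 2 := one_mul _
    rw [show ℓ = z + (ℓ - z) by ring]
    have hzlt : ‖z‖ ^ 2 < ‖z‖ := by
      calc ‖z‖ ^ 2 = ‖z‖ * ‖z‖ := sq _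
        _ < 1 * ‖z‖ := mul_lt_mul_of_pos_right (by linarith) hzz
        _ = ‖z‖ := one_mul _
    have hlt : ‖ℓ - z‖ < ‖z‖ := lt_of_le_of_lt hw hzlt
    rw [norm_add_eq_max_of_norm_ne_norm hlt.ne', max_eq_left hlt.le]
  have hℓ0 : ℓ ≠ 0 := norm_pos_iff.mp (by rw [hℓn]; exact hzz)
  have hLn : ‖L‖ = ‖z‖ ^ 2 := by rw [hL, norm_div, norm_pow, hℓn, hC, div_one]
  have hL0 : L ≠ 0 := norm_pos_iff.mp (by rw [hLn]; positivity)
  have hL81 : ‖L‖ ≤ 1 / 81 := by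
    rw [hLn]
    calc ‖z‖ ^ 2 = ‖z‖ * ‖z‖ := sq _
      _ ≤ (1 / 9) * (1 / 9) := mul_le_mul hz9 hz9 (norm_nonneg _) (by norm_num)
      _ = 1 / 81 := by norm_num
  have hlog2 : ‖padicLog 3 (2 * (c - 1) / L) - (L / 12 - L ^ 2 / 1440)‖ ≤ 81 * ‖L‖ ^ 3 :=
    norm_padicLog_two_mul_coshOfSq_sub_one_div_sub_le hL0 hL81
  have hc1 : ‖c - 1‖ ≤ ‖L‖ := by
    have hL' : ‖L‖ ≤ ((3 : ℝ)⁻¹) ^ 2 := hL81.trans (by norm_num)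
    obtain ⟨R, hR, hRle⟩ := coshOfSq_eq_one_add_half_add (p := 3) (by norm_num) hL'
    rw [hcdef, hR, show 1 + L / 2 + R - 1 = L / 2 + R by ring]
    refine (norm_add_le_max _ _).trans (max_le ?_ (hRle.trans ?_))
    · rw [div_eq_mul_inv, norm_mul, norm_inv, h2n, inv_one, mul_one]
    · calc ‖L‖ * ((3 : ℕ) : ℝ)⁻¹ ≤ ‖L‖ * 1 := by gcongr; norm_num
        _ = ‖L‖ := mul_one _
  have hcn : ‖c‖ ≤ 1 := by
    have hL' : ‖L‖ ≤ ((3 : ℝ)⁻¹) ^ 2 := hL81.trans (by norm_num)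
    exact (norm_coshOfSq_eq_one (p := 3) (by norm_num) hL').le
  have hPr : ‖Pr - 1‖ ≤ ‖q‖ * ‖z‖ ^ 2 := by
    refine (norm_tprod_tateSigmaSq_factor_sub_one_le_mul hq hcn).trans ?_
    rw [← hLn]; gcongr
  have hPr1 : ‖1 - Pr‖ < 1 := by
    rw [norm_sub_rev]; refine hPr.trans_lt ?_
    calc ‖q‖ * ‖z‖ ^ 2 ≤ 1 * ‖z‖ ^ 2 := mul_le_mul_of_nonneg_right hq.le (by positivity)
      _ = ‖z‖ ^ 2 := one_mul _
      _ ≤ ‖z‖ := hz2le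
      _ < 1 := lt_of_le_of_lt hz9 (by norm_num)
  have hPrlin : ‖Pr - (1 - 4 * q * (c - 1))‖ ≤ ‖q‖ ^ 2 * ‖z‖ ^ 2 := by
    refine (KernelCert.norm_tprod_tateSigmaSq_factor_sub_linear_le hq hcn).trans ?_
    rw [← hLn]; gcongr
  have hlogPr : ‖padicLog 3 Pr - (Pr - 1)‖ ≤ (‖q‖ * ‖z‖ ^ 2) ^ 2 := by
    have hu : ‖Pr - 1‖ ≤ 1 / 3 := hPr.trans (by
      calc ‖q‖ * ‖z‖ ^ 2 ≤ 3⁻¹ * 1 := mul_le_mul hq3 (hz2le.trans hz1) (by positivity) (by norm_num)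
        _ = 1 / 3 := by norm_num)
    have h := norm_padicLog_one_add_sub_le_sq hu
    rw [add_sub_cancel] at h
    exact h.trans (by gcongr)
  have hcL : ‖2 * (c - 1) - L‖ ≤ 3 * ‖L‖ ^ 2 :=
    norm_two_mul_coshOfSq_sub_one_sub_le (hL81.trans (by norm_num))
  have hPr0 : Pr ≠ 0 := by
    intro h; rw [h, sub_zero, norm_one] at hPr1; exact lt_irrefl _ hPr1
  have hcr0 : 2 * (c - 1) / L ≠ 0 := by
    intro h
    have h' := hlog2
    rw [h, padicLog_zero] at h'
    -- `‖L/12 − L²/1440‖ = 3‖L‖ > 81‖L‖³`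
    have h1440 : ‖(1440 : ℚ_[3])⁻¹‖ = 9 := by
      have h160 : ‖(160 : ℚ_[3])‖ = 1 := by
        simpa using Padic.norm_natCast_eq_one_iff.mpr (show Nat.Coprime 3 160 by decide)
      rw [show (1440 : ℚ_[3]) = 160 * (3 * 3) by norm_num, mul_inv, mul_inv, norm_mul, norm_mul, h3i,
        norm_inv, h160]; norm_num
    have hLpos : 0 < ‖L‖ := norm_pos_iff.mpr hL0
    have h3L1 : 3 * ‖L‖ < 1 := by linarith
    have hA : ‖L / 12‖ = 3 * ‖L‖ := by rw [div_eq_mul_inv, norm_mul, h12i, mul_comm]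
    have hB : ‖L ^ 2 / 1440‖ < ‖L / 12‖ := by
      rw [hA, div_eq_mul_inv, norm_mul, h1440, norm_pow]
      calc ‖L‖ ^ 2 * 9 = (3 * ‖L‖) * (3 * ‖L‖) := by ring
        _ < 1 * (3 * ‖L‖) := mul_lt_mul_of_pos_right h3L1 (by positivity)
        _ = 3 * ‖L‖ := one_mul _
    have hmain : ‖L / 12 - L ^ 2 / 1440‖ = 3 * ‖L‖ := by
      rw [sub_eq_add_neg, norm_add_eq_max_of_norm_ne_norm (by rw [norm_neg]; exact hB.ne'), norm_neg,
        max_eq_left hB.le, hA]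
    rw [zero_sub, norm_neg, hmain] at h'
    have hlt : 81 * ‖L‖ ^ 3 < 3 * ‖L‖ := by
      calc 81 * ‖L‖ ^ 3 = (81 * ‖L‖ ^ 2) * ‖L‖ := by ring
        _ ≤ (81 * (1 / 81) ^ 2) * ‖L‖ := by gcongr
        _ < 3 * ‖L‖ := mul_lt_mul_of_pos_right (by norm_num) hLpos
    linarith
  -- `ĥ − log num = −log(x Σ²) = −(log(xℓ²) + log(2(c−1)/L) + log Π)`
  have hXℓ0 : X * ℓ ^ 2 ≠ 0 := mul_ne_zero hX0' (pow_ne_zero 2 hℓ0)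
  have hdecomp : heightFourOneCoord W 3 q x y - padicLog 3 ((x.num : ℚ) : ℚ_[3]) =
      -(padicLog 3 (X * ℓ ^ 2) + padicLog 3 (2 * (c - 1) / L) + padicLog 3 Pr) := by
    have hprod : X * tateSigmaValueSq W 3 q x y = (X * ℓ ^ 2) * (2 * (c - 1) / L) * Pr := by
      rw [hSig, hL]; field_simp
    rw [heightFourOneCoord_eq, hnum, padicLog_mul_holds 3 hX0' hd0,
      show padicLog 3 ((x.den : ℚ) : ℚ_[3]) - padicLog 3 (tateSigmaValueSq W 3 q x y) -
        (padicLog 3 X + padicLog 3 ((x.den : ℚ) : ℚ_[3])) =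
        -(padicLog 3 X + padicLog 3 (tateSigmaValueSq W 3 q x y)) by ring,
      ← padicLog_mul_holds 3 hX0' hS0, hprod, padicLog_mul_holds 3 (mul_ne_zero hXℓ0 hcr0) hPr0,
      padicLog_mul_holds 3 hXℓ0 hcr0]
  -- `ℓ² ≡ X⁻¹ − (b₂/12) X⁻²`, `ℓ⁴ ≡ X⁻²`
  have hXi2 : ‖X⁻¹‖ = ‖z‖ ^ 2 := by rw [norm_inv, hXinv]
  clear_value X Y z ℓ C2 L c Pr
  have hXℓ' : ‖X * ℓ ^ 2 - 1 + V.b₂ / 12 * ℓ ^ 2 - (V.b₂ ^ 2 - 24 * V.b₄) / 240 * ℓ ^ 4‖ ≤ ‖z‖ ^ 4 := by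
    rw [← hc4def]; exact hXℓ
  obtain ⟨hK1, hK2, hK3⟩ := deep_conversion hX0' hXi2 hℓn hzz hz9 hb2n hb4n hCi hCb hXℓ'
  rw [← hc4def] at hK2 hK3
  have hℓX : ‖ℓ ^ 2 - X⁻¹‖ ≤ 3 * ‖z‖ ^ 4 := norm_formalLog_sq_sub_inv_le hX0' hXi2 hℓn hzz hz9 hb2n hb4n hXℓ'
  have hK4 : ‖padicLog 3 Pr + 2 * q * (-(V.c₆ / V.c₄)) * X⁻¹‖ ≤ ‖z‖ ^ 2 * max (‖z‖ ^ 2) (‖q‖ ^ 2) :=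
    deep_refined_logPr hq3 hzz hz9 hLn hL hCi hCC0 hXi2 hℓX hPrlin hlogPr hcL
  -- the exact regrouping
  have hfin : heightFourOneCoord W 3 q x y - padicLog 3 ((x.num : ℚ) : ℚ_[3]) -
      κ' * (((x.den : ℚ) : ℚ_[3]) / ((x.num : ℚ) : ℚ_[3])) -
      60 * (V.c₆ / V.c₄) * q * (((x.den : ℚ) : ℚ_[3]) / ((x.num : ℚ) : ℚ_[3])) =
      -(padicLog 3 (X * ℓ ^ 2) - (-(V.b₂ / 12) * ℓ ^ 2 + (V.c₄ / 240 - V.b₂ ^ 2 / 288) * ℓ ^ 4))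
      - (padicLog 3 (2 * (c - 1) / L) - (L / 12 - L ^ 2 / 1440))
      - (C2⁻¹ - V.b₂) / 12 * (ℓ ^ 2 - (X⁻¹ - V.b₂ / 12 * X⁻¹ ^ 2))
      - (6 * V.c₄ - 5 * V.b₂ ^ 2 - C2⁻¹ ^ 2) / 1440 * (ℓ ^ 4 - X⁻¹ ^ 2)
      - ((6 * V.c₄ - 5 * V.b₂ ^ 2 - C2⁻¹ ^ 2) / 1440 - (C2⁻¹ - V.b₂) / 12 * (V.b₂ / 12)) * X⁻¹ ^ 2
      - ((C2⁻¹ - V.b₂) / 12 + κ' + 62 * (V.c₆ / V.c₄) * q) * X⁻¹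
      - (padicLog 3 Pr + 2 * q * (-(V.c₆ / V.c₄)) * X⁻¹) := by
    rw [hdecomp, hnum, hL]
    field_simp
    ring
  rw [hfin, hXinv]
  have hB1 : ‖z‖ ^ 4 ≤ ‖z‖ ^ 2 * max (‖z‖ ^ 2) (‖q‖ ^ 2) := by
    rw [show ‖z‖ ^ 4 = ‖z‖ ^ 2 * ‖z‖ ^ 2 by ring]; gcongr; exact le_max_left _ _
  have hB2 : ‖q‖ ^ 2 * ‖z‖ ^ 2 ≤ ‖z‖ ^ 2 * max (‖z‖ ^ 2) (‖q‖ ^ 2) := by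
    rw [mul_comm]; gcongr; exact le_max_right _ _
  refine (norm_sub_le_max₃ _ _).trans (max_le ((norm_sub_le_max₃ _ _).trans (max_le
    ((norm_sub_le_max₃ _ _).trans (max_le ((norm_sub_le_max₃ _ _).trans (max_le
    ((norm_sub_le_max₃ _ _).trans (max_le ((norm_sub_le_max₃ _ _).trans (max_le ?_ ?_)) ?_)) ?_)) ?_)) ?_)) ?_)
  · rw [norm_neg]; exact hlog1.trans hB1
  · refine (hlog2.trans ?_).trans hB1
    rw [hLn]
    calc 81 * (‖z‖ ^ 2) ^ 3 = (81 * ‖z‖ ^ 2) * ‖z‖ ^ 4 := by ring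
      _ ≤ 1 * ‖z‖ ^ 4 := by gcongr
      _ = ‖z‖ ^ 4 := one_mul _
  · exact hK1.trans hB1
  · exact hK2.trans hB1
  · exact hK3.trans hB1
  · rw [norm_mul, hXi2]
    calc ‖(C2⁻¹ - V.b₂) / 12 + κ' + 62 * (V.c₆ / V.c₄) * q‖ * ‖z‖ ^ 2 ≤ ‖q‖ ^ 2 * ‖z‖ ^ 2 := by gcongr
      _ ≤ _ := hB2
  · exact hK4

end Deep

end Summit.BirchSwinnertonDyer.Rank1Residual.X11b.RegMult.HeightLogNumerator

end
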